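import Summits.HubbardSuperconductivity.HubbardSuperconductivity.Theses.LiebTwin
import Summits.HubbardSuperconductivity.HubbardSuperconductivity.Theorems.LiebTwinRealFlipDefiniteSufficesSpinFlip
import Literature.MathematicalPhysics.QuantumLattice.HubbardTorusFlux
import HarnessLib

/-!
# Route `LiebTwin`, support `RealFlipDefiniteSuffices` (item `stmt-HubbardSuperconductivity-15658`)

Closes `Summit.HubbardSuperconductivity.HubbardSuperconductivity.Theses.LiebTwin.RealFlipDefiniteSuffices`
(Lieb's "W Hermitian WLOG" step as an order statement): at fixed `(U, L, n)`, if every normalised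
`(2n, 0)`-sector ground state `φ` of `hubbardTorus 2 L 1 U` that is REAL with Lieb matrix `liebW n φ`
symmetric or antisymmetric has `a ≤ F_d(φ) = Re⟨φ, Δ_dᴴ Δ_d φ⟩`, then EVERY normalised ground state has
`a ≤ F_d`.

Proof. Let `F = fockRelabel Orb.spinSwap` be the (real, signed-permutation) Fock-space unitary of the
spin exchange `(x, σ) ↦ (x, 1-σ)` and `K` entrywise complex conjugation.
* `K` and `F` map sector eigenvectors at the ground energy to sector eigenvectors at the ground energy:
  `H = hubbardTorus 2 L 1 U` is a real matrix (`hamiltonian_map_conj`) invariant under spin exchange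
  (`relabel_spinSwap_hamiltonianWith`), and both maps preserve the sector `(2n, S^z = 0)`
  (`star_mem_szSector`, `fockRelabel_spinSwap_mulVec_mem_szSector`).
* The sign identity `W(F χ) = (-1)^{n²} W(χ)ᵀ` (helper file
  `LiebTwinRealFlipDefiniteSufficesSpinFlip`, `liebW_fockRelabel_spinSwap_mulVec`): an `F`-eigenvector
  (`F χ = ±χ`) has `W(χ)ᵀ = ±W(χ)`.
* The quadratic form `Q(χ) = ⟨χ, Δ_dᴴ Δ_d χ⟩ = ‖Δ_d χ‖²` and the norm are ADDITIVE over the decomposition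
  `ψ = u + iv`, `u = u₊ + u₋`, `v = v₊ + v₋` into real `F`-eigenvectors: the pair field is a real matrix
  (`pairField_map_star`) and odd under spin exchange (`relabel_spinSwap_pairField`: the singlet
  `c_{x↑}c_{y↓} - c_{x↓}c_{y↑}` changes sign), so `Δ_dᴴ Δ_d` is real and `F`-invariant.
* Each nonzero piece, normalised by a real scalar, is a real flip-definite normalised sector ground state,
  so `Q(piece) ≥ a ‖piece‖²` (`piece_bound`); summing, `F_d(ψ) ≥ a ‖ψ‖² = a`.
Sources: E. H. Lieb, PRL **62** (1989) 1201, proof of Theorem 1 ("we can assume `W` Hermitian");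
H. Tasaki, *Physics and Mathematics of Quantum Many-Body Systems* (2020), §2.1 (real Hamiltonians,
real ground states). No definition and no named fact is introduced.
-/

-- the mandated namespace `Summit.<Summit>.<Problem>.Theorems` repeats `HubbardSuperconductivity`
-- (single-problem summit, D-0017), which the `dupNamespace` linter flags on every declaration
set_option linter.dupNamespace false

noncomputable section

namespace Summit.HubbardSuperconductivity.HubbardSuperconductivity.Theorems.LiebTwinFlip

open Matrix Literature.MathematicalPhysics.QuantumLattice Literature.Probability.LatticeModels
open Summit.HubbardSuperconductivity.HubbardSuperconductivity.Theorems.NodalDiracTwist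
open scoped ComplexOrder

/-! ### The torus: Hamiltonian, pair field, sector ground states -/

section Torus

variable {L : ℕ} [NeZero L]

omit [NeZero L] in
/-- **The Hubbard Hamiltonian of the torus is invariant under spin exchange**,
`Γ H Γ⁻¹ = H` for `Γ = relabel Orb.spinSwap`. Lieb, PRL 62 (1989) 1201 ("the Hamiltonian is symmetric
between the up and the down spins"). [folklore] -/
theorem relabel_spinSwap_hubbardTorus (U : ℝ) :
    relabel (Orb.spinSwap : Orb (FermionTorus 2 L) ≃ Orb (FermionTorus 2 L)) (hubbardTorus 2 L 1 U) =
      hubbardTorus 2 L 1 U := by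
  rw [← hubbardTorusWith_zero]
  exact relabel_spinSwap_hamiltonianWith (fermionTorusGraph 2 L) 1 U 0

/-- **The singlet pair operators are ODD under spin exchange**: `Γ P_x Γ⁻¹ = -P_x`
(`c_{x↑} c_{y↓} - c_{x↓} c_{y↑} ↦ c_{x↓} c_{y↑} - c_{x↑} c_{y↓}`). Scalapino, Phys. Rep. 250 (1995) 329,
§2 eq. (2.2). [folklore] -/
theorem relabel_spinSwap_localPair (g : Site 2 → ℝ) (x : TorusSite 2 L) :
    relabel (Orb.spinSwap : Orb (FermionTorus 2 L) ≃ Orb (FermionTorus 2 L)) (localPair g L x) =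
      -localPair g L x := by
  unfold localPair
  rw [relabel_sum, ← Finset.sum_neg_distrib]
  refine Finset.sum_congr rfl fun e _ => ?_
  rw [relabel_smul, relabel_sub, relabel_mul, relabel_mul, relabel_annihilation, relabel_annihilation,
    relabel_annihilation, relabel_annihilation, Orb.spinSwap_orb, Orb.spinSwap_orb, Orb.spinSwap_orb,
    Orb.spinSwap_orb, Equiv.swap_apply_left, Equiv.swap_apply_right, ← smul_neg, neg_sub]

/-- **The pair field is odd under spin exchange**: `Γ Δ_g Γ⁻¹ = -Δ_g`. [folklore] -/
theorem relabel_spinSwap_pairField (g : Site 2 → ℝ) :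
    relabel (Orb.spinSwap : Orb (FermionTorus 2 L) ≃ Orb (FermionTorus 2 L)) (pairField g L) =
      -pairField g L := by
  unfold pairField
  rw [relabel_sum, ← Finset.sum_neg_distrib]
  exact Finset.sum_congr rfl fun x _ => relabel_spinSwap_localPair g x

/-- Hence `Δ_gᴴ Δ_g` is INVARIANT under spin exchange. [folklore] -/
theorem relabel_spinSwap_pairField_conjTranspose_mul (g : Site 2 → ℝ) :
    relabel (Orb.spinSwap : Orb (FermionTorus 2 L) ≃ Orb (FermionTorus 2 L))
        ((pairField g L)ᴴ * pairField g L) = (pairField g L)ᴴ * pairField g L := by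
  rw [relabel_mul, relabel_conjTranspose, relabel_spinSwap_pairField, conjTranspose_neg, neg_mul_neg]

/-- **The pair field is a real matrix** (`conj Δ_g = Δ_g` entrywise: real form factor, real
Jordan–Wigner matrices). [folklore] -/
theorem pairField_map_star (g : Site 2 → ℝ) :
    (pairField g L).map star = pairField g L := by
  change (pairField g L).map (starRingEnd ℂ) = pairField g L
  unfold pairField localPair
  rw [map_conj_sum]
  refine Finset.sum_congr rfl fun x _ => ?_
  rw [map_conj_sum]
  refine Finset.sum_congr rfl fun e _ => ?_
  rw [map_conj_smul, Complex.conj_ofReal, Matrix.map_sub _ (map_sub (starRingEnd ℂ)), Matrix.map_mul,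
    Matrix.map_mul,
    annihilation_map_conj, annihilation_map_conj, annihilation_map_conj, annihilation_map_conj]

omit [NeZero L] in
/-- **The Hubbard Hamiltonian of the torus is a real matrix.** [folklore] -/
theorem hubbardTorus_map_star (U : ℝ) : (hubbardTorus 2 L 1 U).map star = hubbardTorus 2 L 1 U := by
  change (hamiltonian (fermionTorusGraph 2 L) 1 U).map (starRingEnd ℂ) = _
  exact hamiltonian_map_conj (fermionTorusGraph 2 L) 1 U

omit [NeZero L] in
/-- Complex conjugation maps `H`-eigenvectors of the sector to `H`-eigenvectors of the sector with the
same (real) eigenvalue (`H` is a real matrix). Tasaki (2020) §2.1. [folklore] -/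
theorem eigen_star {U E : ℝ} {n : ℕ} {χ : Fock (Orb (FermionTorus 2 L))}
    (hmem : χ ∈ szSector (2 * n) (0 : ℝ)) (heig : hubbardTorus 2 L 1 U *ᵥ χ = (E : ℂ) • χ) :
    star χ ∈ szSector (2 * n) (0 : ℝ) ∧ hubbardTorus 2 L 1 U *ᵥ star χ = (E : ℂ) • star χ := by
  refine ⟨Literature.MathematicalPhysics.QuantumLattice.star_mem_szSector hmem, ?_⟩
  rw [← hubbardTorus_map_star U, ← star_mulVec_eq_map_star_mulVec, heig, star_smul, Complex.star_def,
    Complex.conj_ofReal]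

omit [NeZero L] in
/-- The spin flip `F` maps `H`-eigenvectors of the sector `(2n, 0)` to `H`-eigenvectors of the sector
with the same eigenvalue (`F H = H F`, `F` preserves the sector). Lieb, PRL 62 (1989) 1201, eq. (2).
[folklore] -/
theorem eigen_flip {U E : ℝ} {n : ℕ} {χ : Fock (Orb (FermionTorus 2 L))}
    (hmem : χ ∈ szSector (2 * n) (0 : ℝ)) (heig : hubbardTorus 2 L 1 U *ᵥ χ = (E : ℂ) • χ) :
    (fockRelabel (Orb.spinSwap : Orb (FermionTorus 2 L) ≃ Orb (FermionTorus 2 L))).val *ᵥ χ ∈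
        szSector (2 * n) (0 : ℝ) ∧
      hubbardTorus 2 L 1 U *ᵥ
          ((fockRelabel (Orb.spinSwap : Orb (FermionTorus 2 L) ≃ Orb (FermionTorus 2 L))).val *ᵥ χ) =
        (E : ℂ) • ((fockRelabel (Orb.spinSwap : Orb (FermionTorus 2 L) ≃ Orb (FermionTorus 2 L))).val *ᵥ χ) := by
  refine ⟨fockRelabel_spinSwap_mulVec_mem_szSector hmem, ?_⟩
  have hc := fockRelabel_commute_of_relabel_eq
    (Orb.spinSwap : Orb (FermionTorus 2 L) ≃ Orb (FermionTorus 2 L)) (relabel_spinSwap_hubbardTorus (L := L) U)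
  rw [mulVec_mulVec, ← hc.eq, ← mulVec_mulVec, heig, mulVec_smul]

/-- **The bound on one piece.** If `w` is a real `H`-eigenvector of the sector `(2n, 0)` at the sector
ground energy which is an eigenvector of the spin flip, `F w = ± w`, then `w` — when nonzero — normalises
to a real flip-definite (`W(w)ᵀ = ± W(w)`, by `liebW_fockRelabel_spinSwap_mulVec`) normalised sector ground
state, so the hypothesis of `RealFlipDefiniteSuffices` gives `re⟨w, Δ_dᴴΔ_d w⟩ ≥ a ‖w‖²`.
Lieb, PRL 62 (1989) 1201, proof of Theorem 1. [folklore] -/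
theorem piece_bound {U a : ℝ} {n : ℕ}
    (hyp : ∀ φ : Fock (Orb (FermionTorus 2 L)), star φ ⬝ᵥ φ = 1 →
      IsGroundStateInSector (hubbardTorus 2 L 1 U) (2 * n) 0 φ → (∀ s, star (φ s) = φ s) →
        ((liebW n φ)ᵀ = liebW n φ ∨ (liebW n φ)ᵀ = -liebW n φ) →
          a ≤ (expect ((pairField dWaveFormFactor L)ᴴ * pairField dWaveFormFactor L) φ).re)
    {w : Fock (Orb (FermionTorus 2 L))} (hreal : star w = w)
    (hmem : w ∈ szSector (2 * n) (0 : ℝ))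
    (heig : hubbardTorus 2 L 1 U *ᵥ w =
      (((hubbardTorus 2 L 1 U).minEnergyOn (szSector (2 * n) 0) : ℝ) : ℂ) • w)
    {ε : ℂ} (hε : ε = 1 ∨ ε = -1)
    (hflip : (fockRelabel (Orb.spinSwap : Orb (FermionTorus 2 L) ≃ Orb (FermionTorus 2 L))).val *ᵥ w =
      ε • w) :
    a * (star w ⬝ᵥ w).re ≤
      (expect ((pairField dWaveFormFactor L)ᴴ * pairField dWaveFormFactor L) w).re := by
  by_cases hw : w = 0
  · subst hw
    simp [expect]
  -- normalise
  set c : ℝ := (star w ⬝ᵥ w).re with hc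
  have hcpos : 0 < c := by
    rw [hc, ← norm_toLp_sq_eq_re]
    have : (WithLp.toLp 2 w : EuclideanSpace ℂ (Finset (Orb (FermionTorus 2 L)))) ≠ 0 := by
      intro h
      exact hw (by simpa using congrArg WithLp.ofLp h)
    positivity
  set r : ℝ := (Real.sqrt c)⁻¹ with hr
  have hr2 : r ^ 2 * c = 1 := by
    rw [hr, inv_pow, Real.sq_sqrt hcpos.le, inv_mul_cancel₀ hcpos.ne']
  set φ : Fock (Orb (FermionTorus 2 L)) := ((r : ℝ) : ℂ) • w with hφ
  have hww : star w ⬝ᵥ w = ((c : ℝ) : ℂ) := by rw [hc]; exact star_dotProduct_self_eq_ofReal_re w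
  have hφ1 : star φ ⬝ᵥ φ = 1 := by
    rw [hφ, star_smul, smul_dotProduct, dotProduct_smul, smul_smul, hww, smul_eq_mul, Complex.star_def,
      Complex.conj_ofReal, ← Complex.ofReal_mul, ← Complex.ofReal_mul, ← Complex.ofReal_one]
    congr 1
    linear_combination hr2
  have hr0 : ((r : ℝ) : ℂ) ≠ 0 := by
    rw [Ne, Complex.ofReal_eq_zero, hr, inv_eq_zero]
    exact (Real.sqrt_pos.2 hcpos).ne'
  have hgs : IsGroundStateInSector (hubbardTorus 2 L 1 U) (2 * n) 0 φ :=
    ⟨Submodule.smul_mem _ _ hmem, smul_ne_zero hr0 hw, by rw [hφ, mulVec_smul, heig, smul_comm]⟩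
  have hφreal : ∀ s, star (φ s) = φ s := by
    intro s
    have hs := congrFun hreal s
    rw [Pi.star_apply] at hs
    rw [hφ, Pi.smul_apply, smul_eq_mul, star_mul', hs, Complex.star_def, Complex.conj_ofReal]
  -- flip-definiteness of `φ` from the sign identity
  have hW : (liebW n w)ᵀ = ((-1 : ℂ) ^ (n * n) * ε) • liebW n w := by
    have h := liebW_fockRelabel_spinSwap_mulVec n w
    rw [hflip, liebW_smul] at h
    -- h : ε • liebW n w = (-1)^(n*n) • (liebW n w)ᵀ
    have hs : ((-1 : ℂ) ^ (n * n)) * (-1 : ℂ) ^ (n * n) = 1 := by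
      rw [← mul_pow, neg_mul_neg, one_mul, one_pow]
    calc (liebW n w)ᵀ = (((-1 : ℂ) ^ (n * n)) * (-1 : ℂ) ^ (n * n)) • (liebW n w)ᵀ := by
          rw [hs, one_smul]
      _ = ((-1 : ℂ) ^ (n * n)) • (ε • liebW n w) := by rw [← smul_smul, ← h]
      _ = ((-1 : ℂ) ^ (n * n) * ε) • liebW n w := smul_smul _ _ _
  have hsign : ((-1 : ℂ) ^ (n * n) * ε) = 1 ∨ ((-1 : ℂ) ^ (n * n) * ε) = -1 := by
    rcases neg_one_pow_eq_or ℂ (n * n) with h | h <;> rcases hε with rfl | rfl <;> simp [h]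
  have hφflip : (liebW n φ)ᵀ = liebW n φ ∨ (liebW n φ)ᵀ = -liebW n φ := by
    rw [hφ, liebW_smul, transpose_smul, hW, smul_comm]
    rcases hsign with h | h
    · left; rw [h, one_smul]
    · right; rw [h, neg_one_smul]
  have key := hyp φ hφ1 hgs hφreal hφflip
  rw [hφ, expect_smul, Complex.star_def, Complex.conj_ofReal, ← Complex.ofReal_mul, Complex.re_ofReal_mul]
    at key
  -- key : a ≤ r * r * Q.re ; want a * c ≤ Q.re
  have hQ := key
  have : a * c ≤ r * r * (expect ((pairField dWaveFormFactor L)ᴴ * pairField dWaveFormFactor L) w).re * c :=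
    mul_le_mul_of_nonneg_right hQ hcpos.le
  calc a * (star w ⬝ᵥ w).re = a * c := by rw [hc]
    _ ≤ r * r * (expect ((pairField dWaveFormFactor L)ᴴ * pairField dWaveFormFactor L) w).re * c := this
    _ = (expect ((pairField dWaveFormFactor L)ᴴ * pairField dWaveFormFactor L) w).re := by
        rw [show r * r = r ^ 2 by ring]
        linear_combination ((expect ((pairField dWaveFormFactor L)ᴴ * pairField dWaveFormFactor L) w).re) * hr2

end Torus

end Summit.HubbardSuperconductivity.HubbardSuperconductivity.Theorems.LiebTwinFlip

/-! ### The route item -/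

namespace Summit.HubbardSuperconductivity.HubbardSuperconductivity.Theorems

open Matrix Literature.MathematicalPhysics.QuantumLattice LiebTwinFlip
open Summit.HubbardSuperconductivity.HubbardSuperconductivity.Theorems.NodalDiracTwist

/-- **Real flip-definite ground states suffice** (route `LiebTwin`, support `RealFlipDefiniteSuffices`,
item `stmt-HubbardSuperconductivity-15658`; Lieb's "W Hermitian WLOG" step as an order statement): at
fixed `(U, L, n)`, if every normalised `(2n, 0)`-sector ground state of `hubbardTorus 2 L 1 U` that is real
with `liebW n φ` symmetric or antisymmetric has `a ≤ Re⟨φ, Δ_dᴴ Δ_d φ⟩`, then EVERY normalised ground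
state `ψ` has `a ≤ Re⟨ψ, Δ_dᴴ Δ_d ψ⟩`: decompose `ψ = u + iv` into real parts and each of `u, v` into the
`±1` eigenvectors of the real spin-flip unitary `F` (all four pieces are real sector eigenvectors at the
ground energy, flip-definite by `W(Fχ) = (-1)^{n²} W(χ)ᵀ`); the form `Re⟨·, Δ_dᴴΔ_d ·⟩` and the norm are
additive over the four pieces, and each piece obeys the bound. Lieb, PRL 62 (1989) 1201, proof of
Theorem 1; Tasaki (2020) §2.1. [folklore] -/
theorem realFlipDefiniteSuffices_proof :
    Summit.HubbardSuperconductivity.HubbardSuperconductivity.Theses.LiebTwin.RealFlipDefiniteSuffices := by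
  intro U a L _ n hyp ψ hψ1 hgs
  obtain ⟨hmem, -, heig⟩ := hgs
  set H := hubbardTorus 2 L 1 U with hH
  set Δ := pairField dWaveFormFactor L with hΔ
  set F := (fockRelabel (Orb.spinSwap : Orb (FermionTorus 2 L) ≃ Orb (FermionTorus 2 L))).val with hF
  set E : ℝ := H.minEnergyOn (szSector (2 * n) 0) with hE
  -- the eigen-module of the sector ground energy: closed under `+`, `-`, scalars, `star`, `F`
  have eig_add : ∀ {χ χ' : Fock (Orb (FermionTorus 2 L))},
      (χ ∈ szSector (2 * n) (0 : ℝ) ∧ H *ᵥ χ = (E : ℂ) • χ) →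
      (χ' ∈ szSector (2 * n) (0 : ℝ) ∧ H *ᵥ χ' = (E : ℂ) • χ') →
        (χ + χ' ∈ szSector (2 * n) (0 : ℝ) ∧ H *ᵥ (χ + χ') = (E : ℂ) • (χ + χ')) :=
    fun {χ χ'} h h' => ⟨Submodule.add_mem _ h.1 h'.1, by rw [mulVec_add, h.2, h'.2, smul_add]⟩
  have eig_sub : ∀ {χ χ' : Fock (Orb (FermionTorus 2 L))},
      (χ ∈ szSector (2 * n) (0 : ℝ) ∧ H *ᵥ χ = (E : ℂ) • χ) →
      (χ' ∈ szSector (2 * n) (0 : ℝ) ∧ H *ᵥ χ' = (E : ℂ) • χ') →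
        (χ - χ' ∈ szSector (2 * n) (0 : ℝ) ∧ H *ᵥ (χ - χ') = (E : ℂ) • (χ - χ')) :=
    fun {χ χ'} h h' => ⟨Submodule.sub_mem _ h.1 h'.1, by rw [mulVec_sub, h.2, h'.2, smul_sub]⟩
  have eig_smul : ∀ (c : ℂ) {χ : Fock (Orb (FermionTorus 2 L))},
      (χ ∈ szSector (2 * n) (0 : ℝ) ∧ H *ᵥ χ = (E : ℂ) • χ) →
        (c • χ ∈ szSector (2 * n) (0 : ℝ) ∧ H *ᵥ (c • χ) = (E : ℂ) • (c • χ)) :=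
    fun c {χ} h => ⟨Submodule.smul_mem _ c h.1, by rw [mulVec_smul, h.2, smul_comm]⟩
  have eig_star : ∀ {χ : Fock (Orb (FermionTorus 2 L))},
      (χ ∈ szSector (2 * n) (0 : ℝ) ∧ H *ᵥ χ = (E : ℂ) • χ) →
        (star χ ∈ szSector (2 * n) (0 : ℝ) ∧ H *ᵥ star χ = (E : ℂ) • star χ) :=
    fun {χ} h => eigen_star h.1 h.2
  have eig_flip : ∀ {χ : Fock (Orb (FermionTorus 2 L))},
      (χ ∈ szSector (2 * n) (0 : ℝ) ∧ H *ᵥ χ = (E : ℂ) • χ) →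
        (F *ᵥ χ ∈ szSector (2 * n) (0 : ℝ) ∧ H *ᵥ (F *ᵥ χ) = (E : ℂ) • (F *ᵥ χ)) :=
    fun {χ} h => eigen_flip h.1 h.2
  have heψ : ψ ∈ szSector (2 * n) (0 : ℝ) ∧ H *ᵥ ψ = (E : ℂ) • ψ := ⟨hmem, heig⟩
  -- real and imaginary parts, as polynomial expressions in `ψ` and `star ψ`
  set u : Fock (Orb (FermionTorus 2 L)) := (1 / 2 : ℂ) • (ψ + star ψ) with hu
  set v : Fock (Orb (FermionTorus 2 L)) := (Complex.I / 2) • (star ψ - ψ) with hv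
  have hψuv : ψ = u + Complex.I • v := by
    rw [hu, hv, smul_smul]
    funext s
    simp only [Pi.add_apply, Pi.smul_apply, Pi.sub_apply, smul_eq_mul]
    linear_combination ((1 : ℂ) / 2 * (ψ s - star ψ s)) * Complex.I_mul_I
  have h12 : star (1 / 2 : ℂ) = 1 / 2 := by simp
  have hI2 : star (Complex.I / 2) = -(Complex.I / 2) := by simp [neg_div]
  have hu_real : star u = u := by
    rw [hu]
    funext s
    simp only [Pi.star_apply, Pi.smul_apply, Pi.add_apply, smul_eq_mul, star_mul', star_add, star_star,
      h12]
    ring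
  have hv_real : star v = v := by
    rw [hv]
    funext s
    simp only [Pi.star_apply, Pi.smul_apply, Pi.sub_apply, smul_eq_mul, star_mul', star_sub, star_star,
      hI2]
    ring
  have heu : u ∈ szSector (2 * n) (0 : ℝ) ∧ H *ᵥ u = (E : ℂ) • u := eig_smul _ (eig_add heψ (eig_star heψ))
  have hev : v ∈ szSector (2 * n) (0 : ℝ) ∧ H *ᵥ v = (E : ℂ) • v := eig_smul _ (eig_sub (eig_star heψ) heψ)
  -- the four real, flip-definite pieces
  set p₁ : Fock (Orb (FermionTorus 2 L)) := (1 / 2 : ℂ) • (u + F *ᵥ u) with hp₁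
  set p₂ : Fock (Orb (FermionTorus 2 L)) := (1 / 2 : ℂ) • (u - F *ᵥ u) with hp₂
  set p₃ : Fock (Orb (FermionTorus 2 L)) := (1 / 2 : ℂ) • (v + F *ᵥ v) with hp₃
  set p₄ : Fock (Orb (FermionTorus 2 L)) := (1 / 2 : ℂ) • (v - F *ᵥ v) with hp₄
  have hFF : ∀ χ : Fock (Orb (FermionTorus 2 L)), F *ᵥ (F *ᵥ χ) = χ :=
    fun χ => fockRelabel_spinSwap_mulVec_mulVec χ
  have hFstar : ∀ χ : Fock (Orb (FermionTorus 2 L)), star (F *ᵥ χ) = F *ᵥ star χ :=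
    fun χ => star_fockRelabel_spinSwap_mulVec χ
  have plus_flip : ∀ w : Fock (Orb (FermionTorus 2 L)),
      F *ᵥ ((1 / 2 : ℂ) • (w + F *ᵥ w)) = (1 : ℂ) • ((1 / 2 : ℂ) • (w + F *ᵥ w)) := by
    intro w
    rw [one_smul, mulVec_smul, mulVec_add, hFF, add_comm]
  have minus_flip : ∀ w : Fock (Orb (FermionTorus 2 L)),
      F *ᵥ ((1 / 2 : ℂ) • (w - F *ᵥ w)) = (-1 : ℂ) • ((1 / 2 : ℂ) • (w - F *ᵥ w)) := by
    intro w
    rw [neg_one_smul, mulVec_smul, mulVec_sub, hFF, ← smul_neg, neg_sub]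
  have plus_real : ∀ w : Fock (Orb (FermionTorus 2 L)), star w = w →
      star ((1 / 2 : ℂ) • (w + F *ᵥ w)) = (1 / 2 : ℂ) • (w + F *ᵥ w) := by
    intro w hw
    rw [star_smul, star_add, hFstar, hw, h12]
  have minus_real : ∀ w : Fock (Orb (FermionTorus 2 L)), star w = w →
      star ((1 / 2 : ℂ) • (w - F *ᵥ w)) = (1 / 2 : ℂ) • (w - F *ᵥ w) := by
    intro w hw
    rw [star_smul, star_sub, hFstar, hw, h12]
  have plus_add_minus : ∀ w : Fock (Orb (FermionTorus 2 L)),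
      (1 / 2 : ℂ) • (w + F *ᵥ w) + (1 / 2 : ℂ) • (w - F *ᵥ w) = w := by
    intro w
    rw [← smul_add, add_add_sub_cancel, ← two_smul ℂ w, smul_smul]
    norm_num
  have he₁ : p₁ ∈ szSector (2 * n) (0 : ℝ) ∧ H *ᵥ p₁ = (E : ℂ) • p₁ := eig_smul _ (eig_add heu (eig_flip heu))
  have he₂ : p₂ ∈ szSector (2 * n) (0 : ℝ) ∧ H *ᵥ p₂ = (E : ℂ) • p₂ := eig_smul _ (eig_sub heu (eig_flip heu))
  have he₃ : p₃ ∈ szSector (2 * n) (0 : ℝ) ∧ H *ᵥ p₃ = (E : ℂ) • p₃ := eig_smul _ (eig_add hev (eig_flip hev))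
  have he₄ : p₄ ∈ szSector (2 * n) (0 : ℝ) ∧ H *ᵥ p₄ = (E : ℂ) • p₄ := eig_smul _ (eig_sub hev (eig_flip hev))
  -- the bound on each piece
  have hb₁ : a * (star p₁ ⬝ᵥ p₁).re ≤ (expect (Δᴴ * Δ) p₁).re :=
    piece_bound hyp (plus_real u hu_real) he₁.1 he₁.2 (Or.inl rfl) (plus_flip u)
  have hb₂ : a * (star p₂ ⬝ᵥ p₂).re ≤ (expect (Δᴴ * Δ) p₂).re :=
    piece_bound hyp (minus_real u hu_real) he₂.1 he₂.2 (Or.inr rfl) (minus_flip u)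
  have hb₃ : a * (star p₃ ⬝ᵥ p₃).re ≤ (expect (Δᴴ * Δ) p₃).re :=
    piece_bound hyp (plus_real v hv_real) he₃.1 he₃.2 (Or.inl rfl) (plus_flip v)
  have hb₄ : a * (star p₄ ⬝ᵥ p₄).re ≤ (expect (Δᴴ * Δ) p₄).re :=
    piece_bound hyp (minus_real v hv_real) he₄.1 he₄.2 (Or.inr rfl) (minus_flip v)
  -- additivity of the form and of the norm
  have hArel : relabel (Orb.spinSwap : Orb (FermionTorus 2 L) ≃ Orb (FermionTorus 2 L)) (Δᴴ * Δ) = Δᴴ * Δ :=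
    relabel_spinSwap_pairField_conjTranspose_mul dWaveFormFactor
  have hp₁' : F *ᵥ p₁ = p₁ := by rw [hp₁, plus_flip u, one_smul]
  have hp₂' : F *ᵥ p₂ = -p₂ := by rw [hp₂, minus_flip u, neg_one_smul]
  have hp₃' : F *ᵥ p₃ = p₃ := by rw [hp₃, plus_flip v, one_smul]
  have hp₄' : F *ᵥ p₄ = -p₄ := by rw [hp₄, minus_flip v, neg_one_smul]
  have hQψ : expect (Δᴴ * Δ) ψ = expect (Δᴴ * Δ) u + expect (Δᴴ * Δ) v := by
    rw [hψuv]
    exact expect_conjTranspose_mul_add_I_smul Δ (pairField_map_star dWaveFormFactor) hu_real hv_real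
  have hQu : expect (Δᴴ * Δ) u = expect (Δᴴ * Δ) p₁ + expect (Δᴴ * Δ) p₂ := by
    conv_lhs => rw [← plus_add_minus u]
    exact expect_add_of_flip hArel hp₁' hp₂'
  have hQv : expect (Δᴴ * Δ) v = expect (Δᴴ * Δ) p₃ + expect (Δᴴ * Δ) p₄ := by
    conv_lhs => rw [← plus_add_minus v]
    exact expect_add_of_flip hArel hp₃' hp₄'
  have hNψ : star ψ ⬝ᵥ ψ = star u ⬝ᵥ u + star v ⬝ᵥ v := by
    conv_lhs => rw [hψuv]
    exact star_add_I_smul_dotProduct hu_real hv_real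
  have hNu : star u ⬝ᵥ u = star p₁ ⬝ᵥ p₁ + star p₂ ⬝ᵥ p₂ := by
    conv_lhs => rw [← plus_add_minus u]
    exact star_add_dotProduct_add_of_flip hp₁' hp₂'
  have hNv : star v ⬝ᵥ v = star p₃ ⬝ᵥ p₃ + star p₄ ⬝ᵥ p₄ := by
    conv_lhs => rw [← plus_add_minus v]
    exact star_add_dotProduct_add_of_flip hp₃' hp₄'
  -- conclude
  have hnorm : (star p₁ ⬝ᵥ p₁).re + (star p₂ ⬝ᵥ p₂).re + (star p₃ ⬝ᵥ p₃).re + (star p₄ ⬝ᵥ p₄).re = 1 := by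
    have h := congrArg Complex.re hψ1
    rw [hNψ, hNu, hNv] at h
    simpa only [Complex.add_re, Complex.one_re, add_assoc] using h
  have hform : (expect (Δᴴ * Δ) ψ).re = (expect (Δᴴ * Δ) p₁).re + (expect (Δᴴ * Δ) p₂).re +
      (expect (Δᴴ * Δ) p₃).re + (expect (Δᴴ * Δ) p₄).re := by
    rw [hQψ, hQu, hQv]
    simp only [Complex.add_re, add_assoc]
  rw [hform]
  calc a = a * ((star p₁ ⬝ᵥ p₁).re + (star p₂ ⬝ᵥ p₂).re + (star p₃ ⬝ᵥ p₃).re + (star p₄ ⬝ᵥ p₄).re) := by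
        rw [hnorm, mul_one]
    _ = a * (star p₁ ⬝ᵥ p₁).re + a * (star p₂ ⬝ᵥ p₂).re + a * (star p₃ ⬝ᵥ p₃).re +
          a * (star p₄ ⬝ᵥ p₄).re := by ring
    _ ≤ (expect (Δᴴ * Δ) p₁).re + (expect (Δᴴ * Δ) p₂).re + (expect (Δᴴ * Δ) p₃).re +
          (expect (Δᴴ * Δ) p₄).re := add_le_add (add_le_add (add_le_add hb₁ hb₂) hb₃) hb₄

end Summit.HubbardSuperconductivity.HubbardSuperconductivity.Theorems

end
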